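import Literature.Geometry.Lorentzian.BoostedKerrSchildDecay

/-!
# Route EIHFluxBalance — `InertialRecession`: uniform `Cᵐ` bounds on the Schwarzschild–Kerr–Schild form

Helper file for the crux `stmt-FinalStateConjecture-10166`
(`Summit.FinalStateConjecture.FinalStateConjecture.Theses.EIHFluxBalance.InertialRecession`).

Near-zone convergence of the re-charted hole charts compares `g_{M,0}(y)[S ·, S ·]` with
`g_{M,0}(y)` on truncated slabs `{t* = τ, r ≤ R(τ)}` which reach down to the horizon `r = 2M`
and grow (`R(τ) → ∞`); the Leibniz estimate needs the derivatives of the stationary Kerr–Schild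
form `g_{M,0} = η + (2M/r) l ⊗ l` bounded UNIFORMLY on `{r ≥ r₀}` for a fixed `r₀ > 0` (not only
on the far shells `{r ≥ 1}` of `Literature.Geometry.Lorentzian.BoostedKerrSchildDecay`). This
file derives that bound from the unit-shell bound of that file by stationarity (translation along
`e₀`) and the homogeneity `g_{M,0}(y) − η = εM (g_{1,0}(εy) − η)`, `ε = 1/‖y̲‖ ≤ 1/r₀`:
* `exists_bound_iteratedFDeriv_ksPert_zero_spin` — `‖Dᵐ (g_{M,0} − η)(y)‖ ≤ C` for `‖y̲‖ ≥ r₀`;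
* `exists_bound_iteratedFDeriv_kerr_zero_spin'` (registered form unprimed) — the same for `g_{M,0}` and all orders `≤ m`.
-/

noncomputable section

open scoped Topology ContDiff
open Filter Set Function Literature.Geometry.Lorentzian

namespace Summit.FinalStateConjecture.FinalStateConjecture.Theorems

/-- **Uniform bound on `{r ≥ r₀}`** for the Schwarzschild–Kerr–Schild perturbation: for every
order `m` and every `r₀ > 0` there is `C` with `‖Dᵐ (g_{M,0} − η)(y)‖ ≤ C` whenever `‖y̲‖ ≥ r₀`.
[folklore] -/
theorem exists_bound_iteratedFDeriv_ksPert_zero_spin (M : ℝ) {r₀ : ℝ} (hr₀ : 0 < r₀) (m : ℕ) :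
    ∃ C : ℝ, 0 ≤ C ∧ ∀ y : E4, r₀ ≤ E4.spatialNorm y →
      ‖iteratedFDeriv ℝ m (fun y ↦ Kerr.bilin M 0 y - Minkowski.bilin) y‖ ≤ C := by
  obtain ⟨B, hB⟩ := exists_bound_iteratedFDeriv_boostedKsPert_one (1 : lorentzGroup) m
  have hB' : ∀ y : E4, y 0 = 0 → E4.spatialNorm y = 1 →
      ‖iteratedFDeriv ℝ m (fun y ↦ Kerr.bilin 1 0 y - Minkowski.bilin) y‖ ≤ B := by
    intro y hy0 hy1
    have hfun : (fun y ↦ boostedKerrBilin 1 0 1 0 y - Minkowski.bilin) =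
        fun y ↦ Kerr.bilin 1 0 y - Minkowski.bilin := by
      funext y; rw [boostedKerrBilin_one_zero]
    have h := hB 0 (by norm_num) y (by rw [poincareInv_zero]; exact hy0)
      (by rw [poincareInv_zero]; exact hy1)
    rwa [hfun] at h
  have hr₀i : 0 ≤ r₀⁻¹ := inv_nonneg.mpr hr₀.le
  refine ⟨|M| * r₀⁻¹ * (r₀⁻¹) ^ m * max B 0,
    mul_nonneg (mul_nonneg (mul_nonneg (abs_nonneg M) hr₀i) (pow_nonneg hr₀i m)) (le_max_right _ _),
    fun y hy ↦ ?_⟩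
  set s := E4.spatialNorm y with hs
  have hs0 : 0 < s := hr₀.trans_le hy
  set ε := s⁻¹ with hε
  have hε0 : 0 < ε := inv_pos.mpr hs0
  have hεr : ε ≤ r₀⁻¹ := by rw [hε]; exact inv_anti₀ hr₀ hy
  -- kill the time coordinate by a translation along `e₀`
  set y' : E4 := y + (-(y 0)) • E4.basisVector 0 with hy'
  have h0sp : E4.spatial (E4.basisVector 0) = 0 := by
    ext i
    simp [E4.spatial_apply, Fin.succ_ne_zero]
  have hsp : E4.spatial y' = E4.spatial y := by
    rw [hy', map_add, map_smul, h0sp, smul_zero, add_zero]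
  have hy'0 : y' 0 = 0 := by simp [hy']
  have hsy' : E4.spatialNorm y' = s := by rw [hs, E4.spatialNorm, E4.spatialNorm, hsp]
  have hder : iteratedFDeriv ℝ m (fun y ↦ Kerr.bilin M 0 y - Minkowski.bilin) y =
      iteratedFDeriv ℝ m (fun y ↦ Kerr.bilin M 0 y - Minkowski.bilin) y' := by
    have hfun : (fun z ↦ Kerr.bilin M 0 (z + (-(y 0)) • E4.basisVector 0) - Minkowski.bilin) =
        fun z ↦ Kerr.bilin M 0 z - Minkowski.bilin := by
      funext z
      refine Kerr.ksPert_eq_of_spatial_eq M 0 ?_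
      rw [map_add, map_smul, h0sp, smul_zero, add_zero]
    have key := iteratedFDeriv_comp_add_right (𝕜 := ℝ)
      (f := fun z ↦ Kerr.bilin M 0 z - Minkowski.bilin) m ((-(y 0)) • E4.basisVector 0) y
    rw [hfun] at key
    rw [key]
  -- the rescaled point on the unit shell
  set y₁ : E4 := ε • y' with hy₁
  have hy₁0 : y₁ 0 = 0 := by simp [hy₁, hy'0]
  have hy₁1 : E4.spatialNorm y₁ = 1 := by
    rw [hy₁, Kerr.spatialNorm_smul, abs_of_pos hε0, hsy', hε, inv_mul_cancel₀ hs0.ne']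
  have hrad₁ : 0 < Kerr.radius 0 y₁ := by
    rw [Kerr.radius_zero_left, hy₁1]; exact one_pos
  have hG : ContDiffAt ℝ m (fun w ↦ Kerr.bilin 1 0 w - Minkowski.bilin) (ε • y') :=
    Kerr.contDiffAt_ksPert hrad₁
  have hfun : (fun y ↦ Kerr.bilin M 0 y - Minkowski.bilin) =
      fun y ↦ (ε * M) • (fun w ↦ Kerr.bilin 1 0 w - Minkowski.bilin) (ε • y) := by
    funext z
    have := Kerr.ksPert_smul hε0 M 0 z
    rw [mul_zero] at this
    rw [this]
  have hkey := norm_iteratedFDeriv_const_smul_comp_smul_le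
    (fun w ↦ Kerr.bilin 1 0 w - Minkowski.bilin) (ε * M) hε0.ne' y' (m := m) hG
  have hB0 : 0 ≤ max B 0 := le_max_right _ _
  calc ‖iteratedFDeriv ℝ m (fun y ↦ Kerr.bilin M 0 y - Minkowski.bilin) y‖
      = ‖iteratedFDeriv ℝ m (fun y ↦ Kerr.bilin M 0 y - Minkowski.bilin) y'‖ := by rw [hder]
    _ = ‖iteratedFDeriv ℝ m (fun y ↦ (ε * M) •
          (fun w ↦ Kerr.bilin 1 0 w - Minkowski.bilin) (ε • y)) y'‖ := by rw [← hfun]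
    _ ≤ |ε * M| * |ε| ^ m *
          ‖iteratedFDeriv ℝ m (fun w ↦ Kerr.bilin 1 0 w - Minkowski.bilin) (ε • y')‖ := hkey
    _ ≤ |ε * M| * |ε| ^ m * max B 0 := by
        gcongr
        exact (hB' y₁ hy₁0 hy₁1).trans (le_max_left _ _)
    _ = |M| * ε * ε ^ m * max B 0 := by rw [abs_mul, abs_of_pos hε0]; ring
    _ ≤ |M| * r₀⁻¹ * (r₀⁻¹) ^ m * max B 0 := by
        have h1 : ε ^ m ≤ (r₀⁻¹) ^ m := pow_le_pow_left₀ hε0.le hεr m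
        have h2 : |M| * ε ≤ |M| * r₀⁻¹ := mul_le_mul_of_nonneg_left hεr (abs_nonneg M)
        exact mul_le_mul_of_nonneg_right
          (mul_le_mul h2 h1 (pow_nonneg hε0.le m) (mul_nonneg (abs_nonneg M) hr₀i)) hB0

/-- **Uniform `Cᵐ` bound on `{r ≥ r₀}`** for the Schwarzschild–Kerr–Schild form itself, all orders
`≤ m` at once. [folklore] -/
theorem exists_bound_iteratedFDeriv_kerr_zero_spin' (M : ℝ) {r₀ : ℝ} (hr₀ : 0 < r₀) (m : ℕ) :
    ∃ C : ℝ, 0 ≤ C ∧ ∀ y : E4, r₀ ≤ E4.spatialNorm y → ∀ j ≤ m,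
      ‖iteratedFDeriv ℝ j (fun y ↦ Kerr.bilin M 0 y) y‖ ≤ C := by
  have h : ∀ j, ∃ C : ℝ, 0 ≤ C ∧ ∀ y : E4, r₀ ≤ E4.spatialNorm y →
      ‖iteratedFDeriv ℝ j (fun y ↦ Kerr.bilin M 0 y - Minkowski.bilin) y‖ ≤ C :=
    fun j ↦ exists_bound_iteratedFDeriv_ksPert_zero_spin M hr₀ j
  choose C hC0 hC using h
  refine ⟨(∑ j ∈ Finset.range (m + 1), C j) + ‖(Minkowski.bilin : E4 →L[ℝ] E4 →L[ℝ] ℝ)‖,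
    add_nonneg (Finset.sum_nonneg fun j _ ↦ hC0 j) (ContinuousLinearMap.opNorm_nonneg _),
    fun y hy j hj ↦ ?_⟩
  have hrad : 0 < Kerr.radius 0 y := by
    rw [Kerr.radius_zero_left]; exact hr₀.trans_le hy
  have hcd : ContDiffAt ℝ j (fun y ↦ Kerr.bilin M 0 y - Minkowski.bilin) y := Kerr.contDiffAt_ksPert hrad
  have hfun : (fun y ↦ Kerr.bilin M 0 y) =
      (fun y ↦ Kerr.bilin M 0 y - Minkowski.bilin) + fun _ ↦ (Minkowski.bilin : E4 →L[ℝ] E4 →L[ℝ] ℝ) := by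
    funext y
    show Kerr.bilin M 0 y = (Kerr.bilin M 0 y - Minkowski.bilin) + Minkowski.bilin
    abel
  have hCj : C j ≤ ∑ i ∈ Finset.range (m + 1), C i :=
    Finset.single_le_sum (fun i _ ↦ hC0 i) (Finset.mem_range.mpr (Nat.lt_succ_of_le hj))
  rw [hfun, iteratedFDeriv_add_apply hcd contDiffAt_const]
  refine (norm_add_le _ _).trans (add_le_add ((hC j y hy).trans hCj) ?_)
  rcases Nat.eq_zero_or_pos j with hj0 | hj0
  · subst hj0
    rw [norm_iteratedFDeriv_zero]
  · rw [iteratedFDeriv_const_of_ne (Nat.pos_iff_ne_zero.mp hj0)]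
    simp only [Pi.zero_apply, norm_zero]
    exact ContinuousLinearMap.opNorm_nonneg _

/-- Registered sub-goal form (stub `exists_bound_iteratedFDeriv_kerr_zero_spin` of the crux item)
of `exists_bound_iteratedFDeriv_kerr_zero_spin'`. [folklore] -/
theorem exists_bound_iteratedFDeriv_kerr_zero_spin : open Literature.Geometry.Lorentzian in ∀ (M : ℝ) {r₀ : ℝ}, 0 < r₀ → ∀ m : ℕ, ∃ C : ℝ, 0 ≤ C ∧ ∀ y : E4, r₀ ≤ E4.spatialNorm y → ∀ j ≤ m, ‖iteratedFDeriv ℝ j (fun y ↦ Kerr.bilin M 0 y) y‖ ≤ C :=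
  fun M _ hr₀ m ↦ exists_bound_iteratedFDeriv_kerr_zero_spin' M hr₀ m

end Summit.FinalStateConjecture.FinalStateConjecture.Theorems

end
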